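import Literature.NumberTheory.Automorphic.FuchsianPoincareSeriesBounded
import Literature.NumberTheory.Automorphic.CuspHeightIsometry
import HarnessLib

/-!
# Unfolding Poincaré series against `L¹(Γ\ℍ)`: `∫_F E_𝔞m(z | ψ) f(z) dμ` for integrable automorphic `f` (Motohashi (2.1.7), Iwaniec Lemma 3.3)
(Motohashi, *Spectral Theory of the Riemann Zeta-Function*, (2.1.7) ("Let `f` be in `L²(F, dμ)` …
this procedure is the unfolding method"), PDF pp. 38–39; Iwaniec, GSM 53, Lemma 3.3, PDF p. 44)

The tree's unfolding of a Selberg–Poincaré series `E_𝔞m(z | ψ)` against an automorphic `f`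
(`FuchsianPoincareSeries.setIntegral_poincare_selbergGen_mul`) asks `f ∘ σ_𝔞` to be BOUNDED; Motohashi's
(2.1.7) is for `f ∈ L²(F)`, and the spectral side of the Kuznetsov formula (his Lemma 2.2, (2.1.16)–(2.1.19))
needs it for the Eisenstein series on the critical line, which is not bounded. Here, for a finite volume
group with a complete system of inequivalent cusps `𝔞ᵢ = σᵢ∞` of width one, `ψ` continuous with
`|ψ(y)| ≤ C y^α` (`α > 1`) and `m ≥ 1`:

  `∫_F E_𝔞ᵢm(z | ψ) f(z) dμ(z) = ∫₀^∞ ψ(y) e^{-2πmy} (∫₀¹ f(σᵢ(x + iy)) e(mx) dx) y⁻² dy`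

for every automorphic `f`, continuous on `ℍ` and INTEGRABLE on `F` (`setIntegral_poincare_selbergGen_mul_of_integrableOn`).
Everything is PROVED (theorems only): the strip function `𝟙_P(w) ψ(y)e(mw) f(σᵢw)` is integrable on `ℍ`
(`integrable_strip_selbergGen_mul_of_integrableOn`) because, by the unfolding of NON-NEGATIVE functions
(`FundamentalDomainUnfolding.setLIntegral_tsum_smul_eq`, Tonelli) and the count of the strip
(`CuspHeightIsometry.tsum_indicator_strip_eq_ennreal`),
`2∫_ℍ 𝟙_P |ψ(y)e(mw)| |f(σᵢw)| dμ = ∫_F |f(z)| Σ_r |p(ω_r σᵢ⁻¹z)| dμ(z) ≤ 2B ∫_F |f| dμ`, the majorant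
Poincaré series `Σ_r |p(ω_r w)| = 2 E_𝔞ᵢ(σᵢw | |p|)` being BOUNDED on `ℍ`
(`FuchsianPoincareSeriesBounded.exists_bound_norm_poincare` applied to `|p|`); then the tree's unfolding
`setIntegral_poincare_mul_eq_iterated` applies.

## References
* [Motohashi1997] Y. Motohashi, *Spectral Theory of the Riemann Zeta-Function*, CUP 1997, (2.1.7), PDF pp. 38–39.
* [Iwaniec2002] H. Iwaniec, *Spectral Methods of Automorphic Forms*, GSM 53, Lemma 3.3 (3.13)–(3.14), PDF p. 44.

Mathlib: `MeasureTheory.MeasurePreserving.lintegral_comp_emb`, `ENNReal.ofReal_tsum_of_nonneg`, `ENNReal.tsum_mul_right`,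
`Complex.ofReal_tsum`, `hasFiniteIntegral_iff_enorm`. Literature: `setLIntegral_tsum_smul_eq`, `measurePreserving_smul`
(`FundamentalDomainUnfolding` & co.), `tsum_indicator_strip_eq_ennreal` (`CuspHeightIsometry`), `conjEquiv`,
`gen_conj_smul_eq_rowLift`, `rows_conj_eq_pairRows`, `setIntegral_poincare_mul_eq_iterated`, `stripGen_eq`,
`summable_norm_poincarePair`, `norm_selbergGen_le`, `continuous_selbergGen`, `selbergGen_vadd_one`
(`FuchsianPoincareSeries`); `exists_bound_norm_poincare`, `norm_le_mul_rpow_of_weight` (`FuchsianPoincareSeriesBounded`).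
-/

noncomputable section

namespace Literature.NumberTheory.Automorphic

open Matrix UpperHalfPlane
open scoped MatrixGroups

namespace Fuchsian

section UnfoldL1

open scoped Pointwise Real _root_.ENNReal
open _root_.MeasureTheory Set Filter

variable {Γ : Subgroup (GL (Fin 2) ℝ)} {h : ℕ} {𝔞 : Fin h → OnePoint ℝ} {σ : Fin h → SL(2, ℝ)} {F : Set ℍ}

/-- **The row sum of `|p(ω_r w)|` is twice the Poincaré series of `|p|`**:
`Σ_r |p(ω_r w)| = 2 ‖E_𝔞(σ_𝔞w | |p|)‖` (both sides are `0` in the non-summable case). [folklore] -/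
theorem tsum_norm_gen_rowLift_eq (σa : SL(2, ℝ)) (p : ℍ → ℂ) (w : ℍ) :
    ∑' r : pairRows Γ σa σa, ‖p (rowLift Γ σa σa r.1 • w)‖ =
      2 * ‖poincarePair Γ σa σa (fun v => ((‖p v‖ : ℝ) : ℂ)) w‖ := by
  unfold poincarePair
  rw [← Complex.ofReal_tsum, norm_mul, Complex.norm_real, Real.norm_of_nonneg (tsum_nonneg fun r => norm_nonneg _),
    show ‖(1 / 2 : ℂ)‖ = 1 / 2 by norm_num]
  ring

/-- **Integrability of the unfolded strip function for `f ∈ L¹(F)`**: for a finite volume group with a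
complete system of inequivalent cusps, `ψ` continuous with `|ψ(y)| ≤ Cy^α` (`α > 1`), `m ≥ 1`, and an
automorphic continuous `f` integrable on `F`, the function `w ↦ 𝟙_P(w) ψ(Im w) e(mw) f(σᵢ w)` is
integrable on `ℍ`. [cite: Motohashi1997, (2.1.7) (proof), PDF p. 39] -/
theorem integrable_strip_selbergGen_mul_of_integrableOn
    (hΓ : Γ ≤ (Matrix.SpecialLinearGroup.toGL : SL(2, ℝ) →* GL (Fin 2) ℝ).range)
    (hneg : (-1 : GL (Fin 2) ℝ) ∈ Γ) (hd : IsDiscreteSubgroup Γ) (hF : IsHypFundamentalDomain Γ F)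
    (hvol : volume F < ⊤)
    (hinfty : ∀ i, (Matrix.SpecialLinearGroup.toGL (σ i) : GL (Fin 2) ℝ) • (OnePoint.infty : OnePoint ℝ) = 𝔞 i)
    (hper : ∀ i, (ConjAct.toConjAct (Matrix.SpecialLinearGroup.toGL (σ i) : GL (Fin 2) ℝ)⁻¹ • Γ).strictPeriods =
      AddSubgroup.zmultiples 1)
    (hineq : ∀ i j, ∀ γ ∈ Γ, γ • 𝔞 i = 𝔞 j → i = j)
    (hcomplete : ∀ c : OnePoint ℝ, IsCusp c Γ → ∃ i, ∃ γ ∈ Γ, γ • 𝔞 i = c)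
    {ψ : ℝ → ℂ} (hψc : ContinuousOn ψ (Ioi 0)) {C α : ℝ} (hα : 1 < α)
    (hψ : ∀ u : ℝ, 0 < u → ‖ψ u‖ ≤ C * u ^ α) {m : ℤ} (hm : 1 ≤ m) (i : Fin h)
    {f : ℍ → ℂ} (hfa : IsAutomorphic Γ f) (hfc : Continuous f) (hfi : IntegrableOn f F) :
    Integrable fun w : ℍ => (cuspStrip 0).indicator (fun _ => (1 : ℂ)) w * (selbergGen ψ m w * f (σ i • w)) := by
  haveI : Countable Γ := hd.countable.to_subtype
  set S : GL (Fin 2) ℝ := Matrix.SpecialLinearGroup.toGL (σ i) with hS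
  set Γ' : Subgroup (GL (Fin 2) ℝ) := ConjAct.toConjAct S⁻¹ • Γ with hΓ'
  have hΓ'le : Γ' ≤ (Matrix.SpecialLinearGroup.toGL : SL(2, ℝ) →* GL (Fin 2) ℝ).range := by
    rw [hΓ', hS, ← map_inv]; exact conj_le_range hΓ (σ i)⁻¹
  have hd' : IsDiscreteSubgroup Γ' := hd.conj _
  have hTa : translSL 1 ∈ cuspPairSet Γ (σ i) (σ i) := translSL_one_mem_cuspPairSet (hper i)
  set p : ℍ → ℂ := selbergGen ψ m with hp
  set Φ : ℍ → ℂ := fun w => (cuspStrip 0).indicator (fun _ => (1 : ℂ)) w * (p w * f (σ i • w)) with hΦ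
  -- the majorant generating function `|p|` and the bound of its Poincaré series
  have hm0 : (0 : ℤ) ≤ m := by omega
  have hm1 : (0 : ℝ) < m := by
    have h1 : (1 : ℝ) ≤ m := by exact_mod_cast hm
    linarith
  set pt : ℍ → ℂ := fun v => ((‖p v‖ : ℝ) : ℂ) with hpt
  have hptc : Continuous pt := Complex.continuous_ofReal.comp (continuous_selbergGen hψc m).norm
  have hpt1 : ∀ w : ℍ, pt ((1 : ℝ) +ᵥ w) = pt w := fun w => by simp only [hpt, hp, selbergGen_vadd_one]
  have hptw : ∀ v : ℍ, ‖pt v‖ ≤ C * v.im ^ α * Real.exp (-(2 * π * m * v.im)) := by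
    intro v
    have e : ‖pt v‖ = ‖p v‖ := by simp [hpt]
    rw [e, hp, norm_selbergGen_eq]
    exact mul_le_mul_of_nonneg_right (hψ v.im v.im_pos) (Real.exp_pos _).le
  obtain ⟨B, hB0, hB⟩ := exists_bound_norm_poincare hΓ hneg hd hF hvol hinfty hper hineq hcomplete hptc hpt1 hα
    (by positivity : 0 < 2 * π * (m : ℝ)) hptw i
  have hpn : ∀ v : ℍ, ‖p v‖ ≤ C * v.im ^ α := fun v => by
    have := norm_le_mul_rpow_of_weight (by positivity : (0 : ℝ) ≤ 2 * π * m) hptw v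
    simpa [hpt] using this
  -- measurability
  have hind : Measurable ((cuspStrip 0).indicator fun _ : ℍ => (1 : ℂ)) :=
    measurable_const.indicator (measurableSet_cuspStrip 0)
  have hmeas : AEStronglyMeasurable Φ volume :=
    hind.aestronglyMeasurable.mul (((continuous_selbergGen hψc m).mul (hfc.comp (continuous_const_smul _))).aestronglyMeasurable)
  have hp1 : ∀ w : ℍ, p ((1 : ℝ) +ᵥ w) = p w := fun w => selbergGen_vadd_one ψ m w
  refine ⟨hmeas, ?_⟩
  -- finite integral through the unfolding of non-negative functions
  rw [hasFiniteIntegral_iff_enorm]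
  set G : ℍ → ℝ≥0∞ := fun v => ‖Φ ((σ i)⁻¹ • v)‖ₑ with hG
  have hme : MeasurableEmbedding (fun v : ℍ => S⁻¹ • v) := (MeasurableEquiv.smul (S⁻¹ : GL (Fin 2) ℝ)).measurableEmbedding
  have eS : ∀ v : ℍ, S⁻¹ • v = (σ i)⁻¹ • v := fun v => by rw [hS, ← map_inv]; rfl
  have e1 : ∫⁻ w, ‖Φ w‖ₑ = ∫⁻ v, G v := by
    have h1 := (measurePreserving_smul (S⁻¹ : GL (Fin 2) ℝ) (volume : Measure ℍ)).lintegral_comp_emb hme (fun w => ‖Φ w‖ₑ)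
    rw [← h1]
    simp only [hG, eS]
  have hGm : AEMeasurable G volume := by
    have h1 : AEMeasurable (fun w : ℍ => ‖Φ w‖ₑ) volume := hmeas.enorm
    have h2 := aemeasurable_comp_smul h1 (S⁻¹ : GL (Fin 2) ℝ)
    refine h2.congr (Eventually.of_forall fun v => ?_)
    simp only [hG, eS]
  have e2 := setLIntegral_tsum_smul_eq hΓ hneg hd.countable hF hGm
  -- the pointwise bound for the unfolded sum
  have e3 : ∀ z : ℍ, ∑' γ : Γ, G ((γ : GL (Fin 2) ℝ) • z) ≤ ENNReal.ofReal (2 * B) * ‖f z‖ₑ := by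
    intro z
    set z' : ℍ := (σ i)⁻¹ • z with hz'
    -- rewrite the summands
    have hsummand : ∀ γ : Γ, G ((γ : GL (Fin 2) ℝ) • z) =
        (cuspStrip 0).indicator (fun _ => (1 : ℝ≥0∞)) (((conjEquiv S γ : Γ') : GL (Fin 2) ℝ) • z') *
          (fun r : Fin 2 → ℝ => ‖p (rowLift Γ (σ i) (σ i) r • z')‖ₑ)
            ((((conjEquiv S γ : Γ') : GL (Fin 2) ℝ) : Matrix (Fin 2) (Fin 2) ℝ) 1) * ‖f z‖ₑ := by
      intro γ
      have e : ((conjEquiv S γ : Γ') : GL (Fin 2) ℝ) • z' = (σ i)⁻¹ • (γ : GL (Fin 2) ℝ) • z := by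
        rw [coe_conjEquiv, hz', ← eS, ← eS, mul_smul, mul_smul, smul_inv_smul]
      simp only [hG, hΦ]
      rw [smul_inv_smul, hfa _ γ.2, enorm_mul, enorm_mul, ← e,
        gen_conj_smul_eq_rowLift hΓ hd hneg (hper i) hp1 (conjEquiv S γ).2, ← mul_assoc]
      congr 1
      congr 1
      by_cases hmem : ((conjEquiv S γ : Γ') : GL (Fin 2) ℝ) • z' ∈ cuspStrip 0
      · rw [Set.indicator_of_mem hmem, Set.indicator_of_mem hmem]; simp
      · rw [Set.indicator_of_notMem hmem, Set.indicator_of_notMem hmem]; simp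
    rw [tsum_congr hsummand, ENNReal.tsum_mul_right]
    gcongr
    -- `Σ_γ 𝟙_P G(row) = Σ_rows G`
    have hrows := tsum_indicator_strip_eq_ennreal hΓ'le hd' (hper i) (fun r : Fin 2 → ℝ => ‖p (rowLift Γ (σ i) (σ i) r • z')‖ₑ) z'
    rw [← (conjEquiv S).tsum_eq] at hrows
    rw [hrows, tsum_congr_set_coe (fun r : Fin 2 → ℝ => ‖p (rowLift Γ (σ i) (σ i) r • z')‖ₑ) (rows_conj_eq_pairRows hΓ (σ i))]
    -- pass to real sums
    have hs : Summable fun r : pairRows Γ (σ i) (σ i) => ‖p (rowLift Γ (σ i) (σ i) r.1 • z')‖ :=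
      summable_norm_poincarePair hΓ hd hTa hα hpn z'
    have hreal : ∑' r : pairRows Γ (σ i) (σ i), ‖p (rowLift Γ (σ i) (σ i) r.1 • z')‖ₑ =
        ENNReal.ofReal (∑' r : pairRows Γ (σ i) (σ i), ‖p (rowLift Γ (σ i) (σ i) r.1 • z')‖) := by
      rw [ENNReal.ofReal_tsum_of_nonneg (fun r => norm_nonneg _) hs]
      exact tsum_congr fun r => (ofReal_norm _).symm
    rw [hreal, tsum_norm_gen_rowLift_eq (σ i) p z']
    refine ENNReal.ofReal_le_ofReal ?_
    have hz : poincarePair Γ (σ i) (σ i) pt z' = poincare Γ (σ i) pt z := rfl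
    rw [hz]
    linarith [hB z]
  -- conclusion
  have e4 : ∫⁻ z in F, ∑' γ : Γ, G ((γ : GL (Fin 2) ℝ) • z) ≤ ENNReal.ofReal (2 * B) * ∫⁻ z in F, ‖f z‖ₑ := by
    rw [← lintegral_const_mul' _ _ ENNReal.ofReal_ne_top]
    exact lintegral_mono fun z => e3 z
  have hfin : ∫⁻ z in F, ‖f z‖ₑ < ⊤ := hfi.2
  have h2G : 2 * ∫⁻ v, G v < ⊤ := by
    rw [← e2]
    exact lt_of_le_of_lt e4 (ENNReal.mul_lt_top ENNReal.ofReal_lt_top hfin)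
  rw [e1]
  have : ∫⁻ v, G v ≤ 2 * ∫⁻ v, G v := le_mul_of_one_le_left zero_le (by norm_num)
  exact lt_of_le_of_lt this h2G

/-- **Motohashi's (2.1.7) for `f ∈ L¹(F)`**: for a finite volume group with a complete system of
inequivalent cusps `𝔞ᵢ = σᵢ∞` of width one, `ψ` continuous with `|ψ(y)| ≤ Cy^α` (`α > 1`), `m ≥ 1`,
and an automorphic `f`, continuous on `ℍ` and integrable on the fundamental domain `F`:

  `∫_F E_𝔞ᵢm(z | ψ) f(z) dμ(z) = ∫₀^∞ ψ(y) e^{-2πmy} (∫₀¹ f(σᵢ(x + iy)) e(mx) dx) y⁻² dy`.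

[cite: Motohashi1997, (2.1.7), PDF pp. 38–39; Iwaniec2002, Lemma 3.3 (3.13)–(3.14), PDF p. 44] -/
theorem setIntegral_poincare_selbergGen_mul_of_integrableOn
    (hΓ : Γ ≤ (Matrix.SpecialLinearGroup.toGL : SL(2, ℝ) →* GL (Fin 2) ℝ).range)
    (hneg : (-1 : GL (Fin 2) ℝ) ∈ Γ) (hd : IsDiscreteSubgroup Γ) (hF : IsHypFundamentalDomain Γ F)
    (hvol : volume F < ⊤)
    (hinfty : ∀ i, (Matrix.SpecialLinearGroup.toGL (σ i) : GL (Fin 2) ℝ) • (OnePoint.infty : OnePoint ℝ) = 𝔞 i)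
    (hper : ∀ i, (ConjAct.toConjAct (Matrix.SpecialLinearGroup.toGL (σ i) : GL (Fin 2) ℝ)⁻¹ • Γ).strictPeriods =
      AddSubgroup.zmultiples 1)
    (hineq : ∀ i j, ∀ γ ∈ Γ, γ • 𝔞 i = 𝔞 j → i = j)
    (hcomplete : ∀ c : OnePoint ℝ, IsCusp c Γ → ∃ i, ∃ γ ∈ Γ, γ • 𝔞 i = c)
    {ψ : ℝ → ℂ} (hψc : ContinuousOn ψ (Ioi 0)) {C α : ℝ} (hα : 1 < α)
    (hψ : ∀ u : ℝ, 0 < u → ‖ψ u‖ ≤ C * u ^ α) {m : ℤ} (hm : 1 ≤ m) (i : Fin h)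
    {f : ℍ → ℂ} (hfa : IsAutomorphic Γ f) (hfc : Continuous f) (hfi : IntegrableOn f F) :
    ∫ z in F, poincare Γ (σ i) (selbergGen ψ m) z * f z =
      ∫ y in Set.Ioi (0 : ℝ), (((y ^ 2)⁻¹ : ℝ) : ℂ) * (ψ y * Complex.exp (-(2 * π * m * y))) *
        ∫ x in (0 : ℝ)..1, f (σ i • ((x : ℝ) +ᵥ UpperHalfPlane.ofComplex ⟨0, y⟩)) *
          Complex.exp (2 * π * Complex.I * m * x) := by
  have hΦ := integrable_strip_selbergGen_mul_of_integrableOn hΓ hneg hd hF hvol hinfty hper hineq hcomplete hψc hα hψ hm i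
    hfa hfc hfi
  -- the strip function in coordinates
  have hint : IntegrableOn (stripGen fun w => selbergGen ψ m w * f (σ i • w)) {z : ℂ | 0 < z.im} := by
    have h1 := (integrable_upperHalfPlane_iff_integrableOn_complex _).mp hΦ
    refine h1.congr_fun (fun z hz => ?_) UpperHalfPlane.isOpen_upperHalfPlaneSet.measurableSet
    dsimp only
    exact (stripGen_eq (fun w => selbergGen ψ m w * f (σ i • w)) hz).symm
  rw [setIntegral_poincare_mul_eq_iterated hΓ hneg hd hF (hper i) (selbergGen_vadd_one ψ m) hfa hint]
  refine setIntegral_congr_fun measurableSet_Ioi fun y hy => ?_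
  have hy' : (0 : ℝ) < y := hy
  rw [mul_assoc, ← intervalIntegral.integral_const_mul (ψ y * Complex.exp (-(2 * π * m * y)))]
  congr 1
  refine intervalIntegral.integral_congr fun x _ => ?_
  have hpt : UpperHalfPlane.ofComplex (⟨x, y⟩ : ℂ) = ((x : ℝ) +ᵥ UpperHalfPlane.ofComplex ⟨0, y⟩ : ℍ) := by
    rw [UpperHalfPlane.ofComplex_apply_of_im_pos (z := (⟨x, y⟩ : ℂ)) hy',
      UpperHalfPlane.ofComplex_apply_of_im_pos (z := (⟨0, y⟩ : ℂ)) hy']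
    ext1
    rw [UpperHalfPlane.coe_vadd]
    apply Complex.ext <;> simp
  rw [hpt]
  unfold selbergGen
  rw [UpperHalfPlane.vadd_im, coe_real_vadd_ofComplex _ hy']
  have him : (UpperHalfPlane.ofComplex (⟨0, y⟩ : ℂ)).im = y := by
    rw [UpperHalfPlane.ofComplex_apply_of_im_pos (z := (⟨0, y⟩ : ℂ)) hy']; rfl
  rw [him]
  have hI : Complex.I * Complex.I = -1 := Complex.I_mul_I
  rw [show (2 * π * Complex.I * m * ((x : ℂ) + Complex.I * y) : ℂ) = -(2 * π * m * y) + 2 * π * Complex.I * m * x by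
      linear_combination (2 * (π : ℂ) * (m * y)) * hI,
    Complex.exp_add]
  ring

end UnfoldL1

end Fuchsian

end Literature.NumberTheory.Automorphic
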